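/-
Copyright (c) 2026. All rights reserved.
Released under Apache 2.0 license as described in the file LICENSE.
-/
import Summits.BirchSwinnertonDyer.BirchSwinnertonDyer.Theorems.ByReductionTypeAtTwoRankOneSigmaHeightTateRate
import Summits.BirchSwinnertonDyer.BirchSwinnertonDyer.Theorems.ByReductionTypeAtTwoRankOneSigmaHeightNeronIterate
import Summits.BirchSwinnertonDyer.BirchSwinnertonDyer.Theorems.ByReductionTypeAtTwoRankOneSigmaHeightEtaPackage
import HarnessLib

/-!
# The level-one `η`-height law modulo `64` (route `ByReductionTypeAtTwo`, crux `RankOneAtTwoBigImageOddLocal`, §54 of the analytic lens memo)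

**Kernel version of the typed candidate `EtaHeightLogFreeLawModSixtyFourAtTwo` (LF64).**  For a `ℤ`-integral Weierstrass
equation `V/ℚ` with `a₁ = 0`, the formally even solution `Σ₀` of the tree's `σ`-ODE with `c = 0` (the `η`-normalisation at the
supersingular prime `2`) and any height datum `D` computed by the `σ`-formula on the good locus, every rational point `Q = (x, y)`
of `2`-adic level one (`‖x‖₂ = 4`) with non-singular reduction at every prime satisfies, with `a = num x`,

  `‖⟨Q, Q⟩_D − ((a − 1) − (a − 1)²/2 + 24a₄ − 32a₃)‖₂ ≤ 1/64`,

i.e. `⟨Q,Q⟩_D ≡ (a − 1) − (a − 1)²/2 + 24a₄ − 32a₃ (mod 64)` — one binary digit beyond the law modulo `32`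
(`ByReductionTypeAtTwoRankOneSigmaHeightLogFreeLaw`).  Proof: the effective Tate formula with two doublings
(`⟨Q,Q⟩ ≡ 16⁻¹·log₂ num x(4Q) (mod 2⁷)`, `…TateRate`), Néron's duplication numerator and denominator applied twice
(`…NeronDuplication`, `…NeronDenominator`) and the integer congruence `num x(4Q) ≡ 1 + 16(a − 1) − 8(a − 1)² + 384a₄ − 512a₃
(mod 2¹⁰)` (`…NeronIterate`), which also gives `‖num x(4Q) − 1‖₂ ≤ 2⁻⁶`, whence `log₂ num x(4Q) ≡ num x(4Q) − 1 (mod 2¹¹)` by the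
third-order logarithm bound (`…LogFreeLaw`).  Census: `v₂(⟨Q,Q⟩_η − law) ≥ 6` on 840/840 level-one rows of the cell's table
(MEMO-an §54 (54.11)).  Printed context: [cite: MazurSteinTate2006, §1] (`σ`-heights, `p` odd in print),
[cite: SilvermanAEC2009, III.2.3(d), VII.2, VIII.9].

## Main statements

* `norm_pairing_sub_quadratic_le_inv_sixtyFour`: the displayed bound.
* `norm_pairing_self_sub_div_le_of_nsmul_eq_sixtyFour`: regulator form — if `m·P = Q` then
  `‖⟨P,P⟩_D − ((a−1) − (a−1)²/2 + 24a₄ − 32a₃)/m²‖₂ ≤ 64⁻¹/‖m‖₂²`.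
* `exists_heightData_levelOne_law_mod_sixtyFour_two`: `Sq`-free packaging over an elliptic `ℤ`-integral `V` with `a₁ = 0` — the
  `η`-datum of `…SigmaHeightEtaPackage` obeys the law modulo `64`.
-/

open scoped Classical

open WeierstrassCurve PowerSeries Literature Literature.NumberTheory.EllipticCurves

namespace Summit.BirchSwinnertonDyer.BirchSwinnertonDyer.Theorems

namespace NaiveSigmaLogAtTwo

/-- **The level-one `η`-height law modulo `64` (kernel form of LF64)**: `‖⟨Q,Q⟩_D − ((a−1) − (a−1)²/2 + 24a₄ − 32a₃)‖₂ ≤ 64⁻¹`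
for a level-one point `Q = (x, y)` (`‖x‖₂ = 4`, `a = num x`) with non-singular reduction everywhere, on a `ℤ`-integral model with
`a₁ = 0`, for any height datum given by the `σ`-formula with the formally even `Σ₀` (`c = 0`).
[cite: SilvermanAEC2009, III.2.3(d), VIII.9] [cite: MazurSteinTate2006, §1] -/
theorem norm_pairing_sub_quadratic_le_inv_sixtyFour (V : WeierstrassCurve ℚ) [V.IsIntegral ℤ] (ha1 : V.a₁ = 0)
    (Sq : ℚ_[2]⟦X⟧) (h0 : constantCoeff Sq = 0) (h1 : coeff 1 Sq = 0) (h2 : coeff 2 Sq = 1) (h3 : coeff 3 Sq = 0)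
    (hODE : (V.baseChange ℚ_[2]).SatisfiesSigmaSqODE Sq 0) (D : PAdicHeightData V 2)
    (hD : ∀ {x y : ℚ} (h : V.toAffine.Nonsingular x y), V.SatisfiesLocalConditions 2 (.some x y h) →
      D.pairing (.some x y h) (.some x y h) = padicLog 2 ((x.den : ℚ) : ℚ_[2]) - padicLog 2 (padicEval Sq (-(x : ℚ_[2]) / y)))
    {x y : ℚ} (h : V.toAffine.Nonsingular x y) (hx : ‖(x : ℚ_[2])‖ = 4)
    (hns : ∀ ℓ : ℕ, ℓ.Prime → V.HasNonsingularReductionAt ℓ x y) :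
    ‖D.pairing (.some x y h) (.some x y h) - (((x.num : ℚ_[2]) - 1) - ((x.num : ℚ_[2]) - 1) ^ 2 / 2
        + 24 * (V.a₄ : ℚ_[2]) - 32 * (V.a₃ : ℚ_[2]))‖ ≤ 64⁻¹ := by
  -- integer coefficients
  obtain ⟨A₂, hA2⟩ : ∃ A : ℤ, V.a₂ = A := ⟨(WeierstrassCurve.integralModel ℤ V).a₂, by
    rw [← WeierstrassCurve.integralModel_a₂_eq ℤ V]; exact eq_intCast _ _⟩
  obtain ⟨A₃, hA3⟩ : ∃ A : ℤ, V.a₃ = A := ⟨(WeierstrassCurve.integralModel ℤ V).a₃, by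
    rw [← WeierstrassCurve.integralModel_a₃_eq ℤ V]; exact eq_intCast _ _⟩
  obtain ⟨A₄, hA4⟩ : ∃ A : ℤ, V.a₄ = A := ⟨(WeierstrassCurve.integralModel ℤ V).a₄, by
    rw [← WeierstrassCurve.integralModel_a₄_eq ℤ V]; exact eq_intCast _ _⟩
  obtain ⟨A₆, hA6⟩ : ∃ A : ℤ, V.a₆ = A := ⟨(WeierstrassCurve.integralModel ℤ V).a₆, by
    rw [← WeierstrassCurve.integralModel_a₆_eq ℤ V]; exact eq_intCast _ _⟩
  have hb2 : V.b₂ = 4 * A₂ := by rw [WeierstrassCurve.b₂, ha1, hA2]; ring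
  have hb4 : V.b₄ = 2 * A₄ := by rw [WeierstrassCurve.b₄, ha1, hA3, hA4]; ring
  have hb6 : V.b₆ = A₃ ^ 2 + 4 * A₆ := by rw [WeierstrassCurve.b₆, hA3, hA6]
  have hb8 : V.b₈ = 4 * A₂ * A₆ + A₂ * A₃ ^ 2 - A₄ ^ 2 := by
    rw [WeierstrassCurve.b₈, ha1, hA2, hA3, hA4, hA6]; ring
  -- the points `2Q` and `4Q`
  have hx4 : (4 : ℝ) ≤ ‖(x : ℚ_[2])‖ := hx.ge
  obtain ⟨x₂, y₂, h₂, e₂⟩ := exists_two_pow_nsmul_eq_some V ha1 h hx4 1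
  obtain ⟨x₄, y₄, h₄, e₄⟩ := exists_two_pow_nsmul_eq_some V ha1 h hx4 2
  have e₂' : (2 : ℕ) • (.some x y h : V.toAffine.Point) = .some x₂ y₂ h₂ := by simpa using e₂
  have e₂₄ : (2 : ℕ) • (.some x₂ y₂ h₂ : V.toAffine.Point) = .some x₄ y₄ h₄ := by
    rw [← e₂', ← mul_nsmul', show (2 * 2 : ℕ) = 2 ^ 2 by norm_num]
    exact e₄
  have hloc₂ := satisfiesLocalConditions_two_pow_nsmul V ha1 h hx4 hns 1 le_rfl h₂ e₂
  dsimp only [WeierstrassCurve.SatisfiesLocalConditions] at hloc₂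
  have hns₂ : ∀ ℓ : ℕ, ℓ.Prime → V.HasNonsingularReductionAt ℓ x₂ y₂ := hloc₂.2.2
  -- Néron twice, as integer identities
  obtain ⟨hN₂, hM₂⟩ := num_den_two_nsmul_eq V h h₂ hns e₂'
  have hN₄ := num_two_nsmul_eq_neronNumerator V h₂ h₄ hns₂ e₂₄
  have ha' : x₂.num = x.num ^ 4 - 2 * A₄ * x.num ^ 2 * (x.den : ℤ) ^ 2
      - 2 * (A₃ ^ 2 + 4 * A₆) * x.num * (x.den : ℤ) ^ 3 - (4 * A₂ * A₆ + A₂ * A₃ ^ 2 - A₄ ^ 2) * (x.den : ℤ) ^ 4 := by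
    apply Int.cast_injective (α := ℚ)
    rw [hN₂, hb4, hb6, hb8]; push_cast; ring
  have hD' : (x₂.den : ℤ) = (x.den : ℤ) * (4 * x.num ^ 3 + 4 * A₂ * x.num ^ 2 * (x.den : ℤ)
      + 2 * (2 * A₄) * x.num * (x.den : ℤ) ^ 2 + (A₃ ^ 2 + 4 * A₆) * (x.den : ℤ) ^ 3) := by
    apply Int.cast_injective (α := ℚ)
    push_cast
    rw [hM₂, hb2, hb4, hb6]
  have ha'' : x₄.num = x₂.num ^ 4 - 2 * A₄ * x₂.num ^ 2 * (x₂.den : ℤ) ^ 2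
      - 2 * (A₃ ^ 2 + 4 * A₆) * x₂.num * (x₂.den : ℤ) ^ 3 - (4 * A₂ * A₆ + A₂ * A₃ ^ 2 - A₄ ^ 2) * (x₂.den : ℤ) ^ 4 := by
    apply Int.cast_injective (α := ℚ)
    rw [hN₄, hb4, hb6, hb8]; push_cast; ring
  -- the shape of a level-one point: `4 ∣ a − 1`, `den x = 4m` with `m` odd
  have h4a : (4 : ℤ) ∣ x.num - 1 := by
    have hq := norm_cast_num_sub_one_le_quarter V h ha1 hx
    have := (Padic.norm_int_le_pow_iff_dvd (p := 2) (x.num - 1) 2).mp (by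
      push_cast; exact hq.trans (by norm_num))
    simpa using this
  have hden : ∃ m : ℤ, Odd m ∧ (x.den : ℤ) = 4 * m := by
    have hndX : ‖(x.den : ℚ_[2])‖ = 4⁻¹ := by
      rw [norm_natCast_den_eq x, hx, max_eq_right (by norm_num : (1 : ℝ) ≤ 4)]
    have hdvd : (2 : ℤ) ^ 2 ∣ (x.den : ℤ) := (Padic.norm_int_le_pow_iff_dvd (p := 2) (x.den : ℤ) 2).mp (by
      rw [Int.cast_natCast, hndX]; norm_num)
    obtain ⟨δ, hδ⟩ := hdvd
    refine ⟨δ, ?_, by linear_combination hδ⟩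
    have hδc : (x.den : ℚ_[2]) = 4 * (δ : ℚ_[2]) := by
      rw [show ((x.den : ℕ) : ℚ_[2]) = ((x.den : ℤ) : ℚ_[2]) by norm_cast, hδ]; push_cast; ring
    have h4n : ‖(4 : ℚ_[2])‖ = 4⁻¹ := by
      rw [show (4 : ℚ_[2]) = 2 * 2 by norm_num, norm_mul, Rank2Observatory.padic_norm_two]; norm_num
    have hδ1 : ‖(δ : ℚ_[2])‖ = 1 := by
      have := hndX; rw [hδc, norm_mul, h4n] at this
      linarith
    rw [← Int.not_even_iff_odd, even_iff_two_dvd]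
    intro h2
    have := Padic.norm_intCast_lt_one_iff.mpr (by exact_mod_cast h2 : (2 : ℤ) ∣ δ)
    rw [hδ1] at this; exact lt_irrefl _ this
  -- the integer congruence modulo `2¹⁰`
  obtain ⟨s, hs⟩ := neronNumerator_iterate_two_congr A₂ A₃ A₄ A₆ x.num (x.den : ℤ) x₂.num (x₂.den : ℤ) x₄.num
    h4a hden ha' hD' ha''
  obtain ⟨u, hu⟩ := h4a
  have hs' : x₄.num = 1 + 64 * u - 128 * u ^ 2 + 384 * A₄ - 512 * A₃ + 1024 * s := by
    rw [hu] at hs; linear_combination hs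
  -- Tate with two doublings: `⟨Q,Q⟩ ≡ 16⁻¹ log₂ num x(4Q) (mod 2⁷)`
  have hT : ‖D.pairing (.some x y h) (.some x y h) - ((4 : ℚ_[2]) ^ 2)⁻¹ * padicLog 2 (x₄.num : ℚ_[2])‖ ≤ 128⁻¹ :=
    (norm_pairing_sub_inv_mul_padicLog_num_le_rate V ha1 Sq h0 h1 h2 h3 hODE D hD h hx4 hns 2 (by norm_num) h₄ e₄).trans
      (by rw [hx]; norm_num)
  -- the logarithm of `num x(4Q) = 1 + t`, `‖t‖ ≤ 2⁻⁶`
  set t : ℚ_[2] := (x₄.num : ℚ_[2]) - 1 with ht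
  have htc : t = 64 * ((u - 2 * u ^ 2 + 6 * A₄ - 8 * A₃ + 16 * s : ℤ) : ℚ_[2]) := by
    have := congrArg (Int.cast : ℤ → ℚ_[2]) hs'
    push_cast at this
    rw [ht, this]; push_cast; ring
  have h2n : ‖(2 : ℚ_[2])‖ = 2⁻¹ := Rank2Observatory.padic_norm_two
  have h64 : ‖(64 : ℚ_[2])‖ = 64⁻¹ := by
    rw [show (64 : ℚ_[2]) = 2 ^ 6 by norm_num, norm_pow, h2n]; norm_num
  have hnt : ‖t‖ ≤ 64⁻¹ := by
    rw [htc, norm_mul, h64]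
    calc (64⁻¹ : ℝ) * ‖((u - 2 * u ^ 2 + 6 * A₄ - 8 * A₃ + 16 * s : ℤ) : ℚ_[2])‖ ≤ 64⁻¹ * 1 := by
          gcongr; exact Padic.norm_int_le_one _
      _ = 64⁻¹ := by norm_num
  have hlog : ‖padicLog 2 (x₄.num : ℚ_[2]) - t‖ ≤ 2048⁻¹ := by
    have e : (x₄.num : ℚ_[2]) = 1 + t := by rw [ht]; ring
    have h3' := norm_padicLog_one_add_sub_add_le (t := t) (hnt.trans (by norm_num))
    rw [e, show padicLog 2 (1 + t) - t = (padicLog 2 (1 + t) - t + t ^ 2 / 2) + -(t ^ 2 / 2) by ring]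
    refine (IsUltrametricDist.norm_add_le_max _ _).trans (max_le ?_ ?_)
    · calc ‖padicLog 2 (1 + t) - t + t ^ 2 / 2‖ ≤ ‖t‖ ^ 3 := h3'
        _ ≤ (64⁻¹ : ℝ) ^ 3 := by gcongr
        _ ≤ 2048⁻¹ := by norm_num
    · rw [norm_neg, norm_div, norm_pow, h2n]
      calc ‖t‖ ^ 2 / (2⁻¹ : ℝ) = 2 * ‖t‖ ^ 2 := by ring
        _ ≤ 2 * (64⁻¹ : ℝ) ^ 2 := by gcongr
        _ = 2048⁻¹ := by norm_num
  -- assemble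
  have hA3c : (V.a₃ : ℚ_[2]) = (A₃ : ℚ_[2]) := by rw [hA3, Rat.cast_intCast]
  have hA4c : (V.a₄ : ℚ_[2]) = (A₄ : ℚ_[2]) := by rw [hA4, Rat.cast_intCast]
  have hxn : (x.num : ℚ_[2]) - 1 = 4 * (u : ℚ_[2]) := by
    have := congrArg (Int.cast : ℤ → ℚ_[2]) hu
    push_cast at this
    exact this
  have key : D.pairing (.some x y h) (.some x y h) - (((x.num : ℚ_[2]) - 1) - ((x.num : ℚ_[2]) - 1) ^ 2 / 2
        + 24 * (V.a₄ : ℚ_[2]) - 32 * (V.a₃ : ℚ_[2])) =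
      (D.pairing (.some x y h) (.some x y h) - ((4 : ℚ_[2]) ^ 2)⁻¹ * padicLog 2 (x₄.num : ℚ_[2]))
        + ((4 : ℚ_[2]) ^ 2)⁻¹ * (padicLog 2 (x₄.num : ℚ_[2]) - t) + 64 * (s : ℚ_[2]) := by
    rw [hA3c, hA4c, hxn, htc]; push_cast; ring
  have h16 : ‖((4 : ℚ_[2]) ^ 2)⁻¹‖ = 16 := by
    rw [norm_inv, norm_pow, show (4 : ℚ_[2]) = 2 ^ 2 by norm_num, norm_pow, h2n]; norm_num
  rw [key]
  refine (IsUltrametricDist.norm_add_le_max _ _).trans (max_le ?_ ?_)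
  · refine (IsUltrametricDist.norm_add_le_max _ _).trans (max_le (hT.trans (by norm_num)) ?_)
    rw [norm_mul, h16]
    calc (16 : ℝ) * ‖padicLog 2 (x₄.num : ℚ_[2]) - t‖ ≤ 16 * 2048⁻¹ := by gcongr
      _ ≤ 64⁻¹ := by norm_num
  · rw [norm_mul, h64]
    calc (64⁻¹ : ℝ) * ‖(s : ℚ_[2])‖ ≤ 64⁻¹ * 1 := by gcongr; exact Padic.norm_int_le_one _
      _ = 64⁻¹ := by norm_num

/-- **Regulator form of the law modulo `64`**: if `m·P = Q` with `Q = (x, y)` of level one (`‖x‖₂ = 4`, non-singular reduction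
everywhere, `a = num x`), then `‖⟨P,P⟩_D − ((a−1) − (a−1)²/2 + 24a₄ − 32a₃)/m²‖₂ ≤ 64⁻¹/‖m‖₂²` (quadraticity `⟨mP,mP⟩ = m²⟨P,P⟩`).
[cite: SilvermanAEC2009, III.2.3(d), VIII.9] [cite: MazurSteinTate2006, §1] -/
theorem norm_pairing_self_sub_div_le_of_nsmul_eq_sixtyFour (V : WeierstrassCurve ℚ) [V.IsIntegral ℤ] (ha1 : V.a₁ = 0)
    (Sq : ℚ_[2]⟦X⟧) (h0 : constantCoeff Sq = 0) (h1 : coeff 1 Sq = 0) (h2 : coeff 2 Sq = 1) (h3 : coeff 3 Sq = 0)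
    (hODE : (V.baseChange ℚ_[2]).SatisfiesSigmaSqODE Sq 0) (D : PAdicHeightData V 2)
    (hD : ∀ {x y : ℚ} (h : V.toAffine.Nonsingular x y), V.SatisfiesLocalConditions 2 (.some x y h) →
      D.pairing (.some x y h) (.some x y h) = padicLog 2 ((x.den : ℚ) : ℚ_[2]) - padicLog 2 (padicEval Sq (-(x : ℚ_[2]) / y)))
    (P : V.toAffine.Point) {m : ℕ} (hm0 : m ≠ 0) {x y : ℚ} (h : V.toAffine.Nonsingular x y)
    (hm : m • P = .some x y h) (hx : ‖(x : ℚ_[2])‖ = 4) (hns : ∀ ℓ : ℕ, ℓ.Prime → V.HasNonsingularReductionAt ℓ x y) :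
    ‖D.pairing P P - (((x.num : ℚ_[2]) - 1) - ((x.num : ℚ_[2]) - 1) ^ 2 / 2
        + 24 * (V.a₄ : ℚ_[2]) - 32 * (V.a₃ : ℚ_[2])) / (m : ℚ_[2]) ^ 2‖ ≤ 64⁻¹ / ‖(m : ℚ_[2])‖ ^ 2 := by
  set q : ℚ_[2] := ((x.num : ℚ_[2]) - 1) - ((x.num : ℚ_[2]) - 1) ^ 2 / 2 + 24 * (V.a₄ : ℚ_[2]) - 32 * (V.a₃ : ℚ_[2])
    with hq
  have hQ := norm_pairing_sub_quadratic_le_inv_sixtyFour V ha1 Sq h0 h1 h2 h3 hODE D hD h hx hns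
  rw [← hq] at hQ
  have hmm : (m : ℚ_[2]) ≠ 0 := by exact_mod_cast hm0
  have hsc : D.pairing (.some x y h) (.some x y h) = (m : ℚ_[2]) ^ 2 * D.pairing P P := by
    rw [← hm, pairing_nsmul_nsmul]
  have e : D.pairing P P - q / (m : ℚ_[2]) ^ 2 = (D.pairing (.some x y h) (.some x y h) - q) / (m : ℚ_[2]) ^ 2 := by
    rw [hsc]; field_simp
  rw [e, norm_div, norm_pow]
  have hm1 : (0 : ℝ) < ‖(m : ℚ_[2])‖ ^ 2 := by positivity
  exact div_le_div_of_nonneg_right hQ hm1.le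

/-- **`Sq`-free packaging**: over an elliptic `ℤ`-integral `V/ℚ` with `a₁ = 0`, the `η`-datum of `exists_etaHeightData_two` obeys the
level-one law modulo `64`: `‖⟨Q,Q⟩_D − ((a−1) − (a−1)²/2 + 24a₄ − 32a₃)‖₂ ≤ 64⁻¹` for every level-one point `Q` with non-singular
reduction everywhere. [cite: SilvermanAEC2009, III.2.3(d), VIII.9] [cite: MazurSteinTate2006, §1] -/
theorem exists_heightData_levelOne_law_mod_sixtyFour_two (V : WeierstrassCurve ℚ) [V.IsElliptic] [V.IsIntegral ℤ]
    (ha1 : V.a₁ = 0) :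
    ∃ D : PAdicHeightData V 2, ∀ {x y : ℚ} (h : V.toAffine.Nonsingular x y), ‖(x : ℚ_[2])‖ = 4 →
      (∀ ℓ : ℕ, ℓ.Prime → V.HasNonsingularReductionAt ℓ x y) →
      ‖D.pairing (.some x y h) (.some x y h) - (((x.num : ℚ_[2]) - 1) - ((x.num : ℚ_[2]) - 1) ^ 2 / 2
        + 24 * (V.a₄ : ℚ_[2]) - 32 * (V.a₃ : ℚ_[2]))‖ ≤ 64⁻¹ := by
  obtain ⟨Sq, D, h0, h1, h2, h3, hODE, hD⟩ := exists_etaHeightData_two V ha1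
  exact ⟨D, fun h hx hns => norm_pairing_sub_quadratic_le_inv_sixtyFour V ha1 Sq h0 h1 h2 h3 hODE D hD h hx hns⟩

end NaiveSigmaLogAtTwo

end Summit.BirchSwinnertonDyer.BirchSwinnertonDyer.Theorems
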